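import Summits.Ventures.PercRepro.C026Contract
import Summits.Ventures.PercRepro.C026ClusterFlip

/-!
# mine-3's Theorems Q′ and C: the deletion–contraction defect at `a/b`-edges and at `c`-edges (p5, gen 15)

mine-3 (`proofs/MINE3-FLIPS.md` §2–§4). For an edge `e = uv` of a marked multigraph `H` and `G := H − e`, the
defect set `DB(e)` (`DCDefect ω a b c u v`, every connection read in `G`) is
`{S ⊆ E(G) : a ≁_S b; (a ~_S u ∧ v ~_S b) ∨ (a ~_S v ∧ u ~_S b); c ≁_{S̄} a, c ≁_{S̄} b;
(c ~_{S̄} u ∧ v ~_{S̄} {a, b}) ∨ (c ~_{S̄} v ∧ u ~_{S̄} {a, b})}`, and `H / e` is `G.contract u v`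
(C026Contract: `u` merged into `v`), whose configurations are the subsets of `E(G)`.

* `conn_kSwapInv_of_not_conn_compl` — an open path of the closed-cluster flip `Φ(S)` (C026ClusterFlip's
  `kSwapInv c`) from a vertex outside `D = Com_c(S̄)` stays outside `D` and is an open path of `S`;
* **THEOREM Q′** (`e = xb`): `dcDefect_xb_imp` (`DB(xb)` lies in the middle set `{a ≁_S b, x ∈ D, a ∉ D, b ∉ D}`),
  `kSwapInv_of_middle` (`Φ` carries the middle set to `{c ~ x, a ≁ x, b ≁ x, a ≁ b}`),
  `card_middle_le_card_cell_contract` and **`card_dcDefect_xb_le`**: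
  `#DB(xb) ≤ #{a ≁_S b, x ∈ D, a ∉ D, b ∉ D} ≤ #bc|a(H / e)`; the mirror **`card_dcDefect_xa_le`**: `#DB(xa) ≤ #ac|b(H / e)`;
* **THEOREM C** (`e = cv`): (a) **`dcDefect_cv_mem_cell`** (`DB(cv) ⊆ ac|b(G) ⊔ bc|a(G)`); (b) **`card_dcDefect_cv_le`**:
  `#DB(cv) ≤ #ac|b(H / e) + #bc|a(H / e)` — the open-cluster flip `kSwap m` at the mark `m` open-joined to `v`
  sends each half of `DB(cv)` injectively into a half of `{the closed cluster of the merged vertex holds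
  exactly one mark}` (`kSwap_oneMark_contract`), whose size is `#ac|b(H / e) + #bc|a(H / e)` by Lemma Φ (iv) on
  `H / e` (`card_oneMark_compl_eq` on `G.contract v c`).
-/

namespace PercRepro

open Finset

namespace MultiGraph

section DefectFlips

variable {V E : Type*} (G : MultiGraph V E)

/-- **mine-3's defect set `DB(e)`** of the edge `e = uv` of `H`, on the configurations of `G = H − e`:
`a ≁_S b`; `u` and `v` are open-joined to the two marks `a, b` in one of the two ways; the closed cluster of
`c` misses `a` and `b`; one of `u, v` is closed-joined to `c` and the other to a mark. -/
def DCDefect (ω : Config E) (a b c u v : V) : Prop :=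
  ¬ G.Conn ω a b ∧ ((G.Conn ω a u ∧ G.Conn ω v b) ∨ (G.Conn ω a v ∧ G.Conn ω u b)) ∧
    ¬ G.Conn ωᶜ c a ∧ ¬ G.Conn ωᶜ c b ∧
      ((G.Conn ωᶜ c u ∧ (G.Conn ωᶜ v a ∨ G.Conn ωᶜ v b)) ∨
        (G.Conn ωᶜ c v ∧ (G.Conn ωᶜ u a ∨ G.Conn ωᶜ u b)))

variable {G}

/-! ### Open paths of the closed-cluster flip from outside `D` -/

/-- An edge whose two endpoints lie outside `X` is not at `X`. -/
theorem notMem_edgesAt_of_ends_notMem {X : Set V} {e : E} {x y : V}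
    (hend : (G.fst e = x ∧ G.snd e = y) ∨ (G.fst e = y ∧ G.snd e = x)) (hx : x ∉ X) (hy : y ∉ X) :
    e ∉ G.edgesAt X := by
  intro he
  rcases hend with ⟨h1, h2⟩ | ⟨h1, h2⟩ <;> rcases he with he | he
  · exact hx (h1 ▸ he)
  · exact hy (h2 ▸ he)
  · exact hy (h1 ▸ he)
  · exact hx (h2 ▸ he)

/-- An open path of `Φ(S) = kSwapInv c S` from a vertex `u ∉ D = Com_c(S̄)` never enters `D` (every boundary
edge of `D` is closed in `Φ(S)`), so it uses only edges away from `D`, where `Φ(S) = S`: it is an open path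
of `S`. -/
theorem conn_kSwapInv_of_not_conn_compl {c u : V} {ω : Config E} (hu : ¬ G.Conn ωᶜ c u) {v : V}
    (h : G.Conn (G.kSwapInv c ω) u v) : ¬ G.Conn ωᶜ c v ∧ G.Conn ω u v := by
  refine Conn.induction (motive := fun x => ¬ G.Conn ωᶜ c x ∧ G.Conn ω u x)
    ⟨hu, Conn.refl G ω u⟩ ?_ h
  intro x y _ hxy ih
  obtain ⟨hxD, hux⟩ := ih
  obtain ⟨e, he, hend⟩ := hxy
  have hyD : ¬ G.Conn ωᶜ c y := by
    intro hyD
    -- the edge is at `D`, hence flipped: open in `Φ(S)` means closed in `S`; then `x ∈ D` too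
    rcases hend with ⟨h1, h2⟩ | ⟨h1, h2⟩
    · have heD : e ∈ G.edgesAt (G.cluster ωᶜ c) := Or.inr (by rw [h2]; exact hyD)
      rw [kSwapInv_apply_of_mem heD, ← compl_apply_not] at he
      exact hxD (by rw [← h1]; exact G.fst_mem_cluster_of_open he (by rw [h2]; exact hyD))
    · have heD : e ∈ G.edgesAt (G.cluster ωᶜ c) := Or.inl (by rw [h1]; exact hyD)
      rw [kSwapInv_apply_of_mem heD, ← compl_apply_not] at he
      exact hxD (by rw [← h2]; exact G.snd_mem_cluster_of_open he (by rw [h1]; exact hyD))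
  have heD : e ∉ G.edgesAt (G.cluster ωᶜ c) := notMem_edgesAt_of_ends_notMem hend hxD hyD
  rw [kSwapInv_apply_of_notMem heD] at he
  exact ⟨hyD, hux.tail ⟨e, he, hend⟩⟩

/-! ### THEOREM Q′: the edges at a mark, the contraction side -/

/-- `DB(xb)` lies in the middle set: `a ≁_S b`, `x ∈ D`, `a ∉ D`, `b ∉ D` (`D = Com_c(S̄)`). -/
theorem dcDefect_xb_imp {ω : Config E} {a b c x : V} (h : G.DCDefect ω a b c x b) :
    ¬ G.Conn ω a b ∧ G.Conn ωᶜ c x ∧ ¬ G.Conn ωᶜ c a ∧ ¬ G.Conn ωᶜ c b := by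
  obtain ⟨hab, _, hca, hcb, hcl⟩ := h
  refine ⟨hab, ?_, hca, hcb⟩
  rcases hcl with ⟨hcx, _⟩ | ⟨hcb', _⟩
  · exact hcx
  · exact absurd hcb' hcb

/-- `DB(xa)` lies in the same middle set. -/
theorem dcDefect_xa_imp {ω : Config E} {a b c x : V} (h : G.DCDefect ω a b c x a) :
    ¬ G.Conn ω a b ∧ G.Conn ωᶜ c x ∧ ¬ G.Conn ωᶜ c a ∧ ¬ G.Conn ωᶜ c b := by
  obtain ⟨hab, _, hca, hcb, hcl⟩ := h
  refine ⟨hab, ?_, hca, hcb⟩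
  rcases hcl with ⟨hcx, _⟩ | ⟨hca', _⟩
  · exact hcx
  · exact absurd hca' hca

/-- **Theorem Q′, the image**: for `S` in the middle set, `Φ(S)` has `c ~ x` (Lemma Φ: `Com_c(Φ(S)) = D ∋ x`),
`a ≁ x`, `b ≁ x` (`a, b ∉ D`) and `a ≁ b` (an open `a`–`b` path of `Φ(S)` would be one of `S`). -/
theorem kSwapInv_of_middle {ω : Config E} {a b c x : V}
    (h : ¬ G.Conn ω a b ∧ G.Conn ωᶜ c x ∧ ¬ G.Conn ωᶜ c a ∧ ¬ G.Conn ωᶜ c b) :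
    G.Conn (G.kSwapInv c ω) c x ∧ ¬ G.Conn (G.kSwapInv c ω) a x ∧ ¬ G.Conn (G.kSwapInv c ω) b x ∧
      ¬ G.Conn (G.kSwapInv c ω) a b := by
  obtain ⟨hab, hcx, hca, hcb⟩ := h
  refine ⟨(conn_kSwapInv_iff c x ω).mpr hcx, fun hax => ?_, fun hbx => ?_, fun hab' => ?_⟩
  · exact (conn_kSwapInv_of_not_conn_compl hca hax).1 hcx
  · exact (conn_kSwapInv_of_not_conn_compl hcb hbx).1 hcx
  · exact hab (conn_kSwapInv_of_not_conn_compl hca hab').2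

/-- **Theorem Q′ in `H / e`**, `e = xb` (`x ≠ c`): `Φ` sends the middle set into the cell `bc|a` of
`H / e = G.contract x b` (the merged vertex is `b`): `c ~ b` and `a ≁ b` there. -/
theorem kSwapInv_mem_cell_contract_of_middle {ω : Config E} {a b c x : V} (hcx : c ≠ x)
    (h : ¬ G.Conn ω a b ∧ G.Conn ωᶜ c x ∧ ¬ G.Conn ωᶜ c a ∧ ¬ G.Conn ωᶜ c b) :
    (G.contract x b).Conn (G.kSwapInv c ω) c b ∧ ¬ (G.contract x b).Conn (G.kSwapInv c ω) a b := by
  obtain ⟨h1, h2, _, h4⟩ := kSwapInv_of_middle h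
  constructor
  · have := conn_contract_of_conn (u := x) (v := b) h1
    rwa [mergeTo_of_ne hcx, mergeTo_self] at this
  · intro hab
    rcases conn_contract_imp hab with hab | ⟨hax | hab, _⟩
    · exact h4 hab
    · exact h2 hax
    · exact h4 hab

/-- The mirror: `Φ` sends the middle set into the cell `ac|b` of `H / e = G.contract x a` (`e = xa`). -/
theorem kSwapInv_mem_cell_contract_of_middle' {ω : Config E} {a b c x : V} (hcx : c ≠ x)
    (h : ¬ G.Conn ω a b ∧ G.Conn ωᶜ c x ∧ ¬ G.Conn ωᶜ c a ∧ ¬ G.Conn ωᶜ c b) :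
    (G.contract x a).Conn (G.kSwapInv c ω) c a ∧ ¬ (G.contract x a).Conn (G.kSwapInv c ω) b a := by
  obtain ⟨h1, _, h3, h4⟩ := kSwapInv_of_middle h
  constructor
  · have := conn_contract_of_conn (u := x) (v := a) h1
    rwa [mergeTo_of_ne hcx, mergeTo_self] at this
  · intro hba
    rcases conn_contract_imp hba with hba | ⟨hbx | hba, _⟩
    · exact h4 hba.symm
    · exact h3 hbx
    · exact h4 hba.symm

/-- `Φ = kSwapInv c` is injective (Lemma Φ (ii): the open-cluster flip undoes it). -/
theorem kSwapInv_injective (c : V) : Function.Injective (G.kSwapInv c) := by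
  intro ω ω' h
  have := congrArg (G.kSwap c) h
  rwa [kSwap_kSwapInv, kSwap_kSwapInv] at this

open Classical in
/-- **THEOREM Q′ (the count)**: `#{a ≁_S b, x ∈ D, a ∉ D, b ∉ D} ≤ #bc|a(H / e)` for `e = xb`, `x ≠ c`
(`H / e = G.contract x b`, merged vertex `b`). -/
theorem card_middle_le_card_cell_contract [Fintype E] {c x : V} (hcx : c ≠ x) (a b : V) :
    (univ.filter fun ω : Config E =>
        ¬ G.Conn ω a b ∧ G.Conn ωᶜ c x ∧ ¬ G.Conn ωᶜ c a ∧ ¬ G.Conn ωᶜ c b).card ≤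
      (univ.filter fun ω : Config E =>
        (G.contract x b).Conn ω c b ∧ ¬ (G.contract x b).Conn ω a b).card := by
  refine Finset.card_le_card_of_injOn (G.kSwapInv c) ?_ ((kSwapInv_injective c).injOn)
  intro ω hω
  simp only [Finset.coe_filter, Finset.mem_univ, true_and, Set.mem_setOf_eq] at hω ⊢
  exact kSwapInv_mem_cell_contract_of_middle hcx hω

open Classical in
/-- **THEOREM Q′**: `#DB(xb) ≤ #bc|a(H / e)` for an edge `e = xb` of `H` with `x ≠ c` (`G = H − e`,
`H / e = G.contract x b`, merged vertex `b`). -/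
theorem card_dcDefect_xb_le [Fintype E] {c x : V} (hcx : c ≠ x) (a b : V) :
    (univ.filter fun ω : Config E => G.DCDefect ω a b c x b).card ≤
      (univ.filter fun ω : Config E =>
        (G.contract x b).Conn ω c b ∧ ¬ (G.contract x b).Conn ω a b).card := by
  refine le_trans (Finset.card_le_card ?_) (card_middle_le_card_cell_contract hcx a b)
  intro ω hω
  simp only [Finset.mem_filter, Finset.mem_univ, true_and] at hω ⊢
  exact dcDefect_xb_imp hω

open Classical in
/-- **THEOREM Q′, the mirror**: `#DB(xa) ≤ #ac|b(H / e)` for an edge `e = xa` of `H` with `x ≠ c`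
(`H / e = G.contract x a`, merged vertex `a`). -/
theorem card_dcDefect_xa_le [Fintype E] {c x : V} (hcx : c ≠ x) (a b : V) :
    (univ.filter fun ω : Config E => G.DCDefect ω a b c x a).card ≤
      (univ.filter fun ω : Config E =>
        (G.contract x a).Conn ω c a ∧ ¬ (G.contract x a).Conn ω b a).card := by
  have hmid : (univ.filter fun ω : Config E =>
      ¬ G.Conn ω a b ∧ G.Conn ωᶜ c x ∧ ¬ G.Conn ωᶜ c a ∧ ¬ G.Conn ωᶜ c b).card ≤
      (univ.filter fun ω : Config E =>
        (G.contract x a).Conn ω c a ∧ ¬ (G.contract x a).Conn ω b a).card := by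
    refine Finset.card_le_card_of_injOn (G.kSwapInv c) ?_ ((kSwapInv_injective c).injOn)
    intro ω hω
    simp only [Finset.coe_filter, Finset.mem_univ, true_and, Set.mem_setOf_eq] at hω ⊢
    exact kSwapInv_mem_cell_contract_of_middle' hcx hω
  refine le_trans (Finset.card_le_card ?_) hmid
  intro ω hω
  simp only [Finset.mem_filter, Finset.mem_univ, true_and] at hω ⊢
  exact dcDefect_xa_imp hω

/-! ### THEOREM C: the edges at `c`, both sides -/

/-- **THEOREM C (a)**: `DB(cv) ⊆ ac|b(G) ⊔ bc|a(G)` — `c` is open-joined to exactly one mark. -/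
theorem dcDefect_cv_mem_cell {ω : Config E} {a b c v : V} (h : G.DCDefect ω a b c c v) :
    (G.Conn ω c a ∧ ¬ G.Conn ω c b) ∨ (G.Conn ω c b ∧ ¬ G.Conn ω c a) := by
  obtain ⟨hab, hop, _⟩ := h
  rcases hop with ⟨hac, _⟩ | ⟨_, hcb⟩
  · exact Or.inl ⟨hac.symm, fun hcb => hab (hac.trans hcb)⟩
  · exact Or.inr ⟨hcb, fun hca => hab (hca.symm.trans hcb)⟩

/-- **Theorem C (b), the image**: for `S` with `v ~_S m`, `m ≁_S m'` and `c ≁_{S̄} m'`, the open-cluster flip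
`S' = S Δ E_inc(Com_m(S))` has, in `H / e = G.contract v c` (`e = cv`, merged vertex `c`), the mark `m` inside
the closed cluster of `c` and the mark `m'` outside it: the closed cluster of `m` in `S'` is `M = Com_m(S) ∋ v`
(the cut lemma), and the closed cluster of `c` in `S'` is `M` (if `c ∈ M`) or lies inside `Com_c(S̄) ∌ m'`
(a closed path of `S'` from `c ∉ M` is a closed path of `S`). -/
theorem kSwap_oneMark_contract {ω : Config E} {c v m m' : V} (hmv : m ≠ v) (hvm : G.Conn ω m v)
    (hmm : ¬ G.Conn ω m m') (hcm : ¬ G.Conn ωᶜ c m') :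
    (G.contract v c).Conn (G.kSwap m ω)ᶜ c m ∧ ¬ (G.contract v c).Conn (G.kSwap m ω)ᶜ c m' := by
  have hTmv : G.Conn (G.kSwap m ω)ᶜ m v := (G.conn_compl_kSwap_iff m v ω).mpr hvm
  have hTmm : ¬ G.Conn (G.kSwap m ω)ᶜ m m' := fun h => hmm ((G.conn_compl_kSwap_iff m m' ω).mp h)
  -- `c` and `m'` are not closed-joined in `S'`
  have hcm' : ¬ G.Conn (G.kSwap m ω)ᶜ c m' := by
    intro h
    by_cases hc : G.Conn ω m c
    · exact hTmm (((G.conn_compl_kSwap_iff m c ω).mpr hc).trans h)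
    · have hΦ : G.kSwapInv m ωᶜ = (G.kSwap m ω)ᶜ := by
        rw [kSwapInv_eq_compl_kSwap_compl, compl_compl]
      rw [← hΦ] at h
      have hc' : ¬ G.Conn ωᶜᶜ m c := by rwa [compl_compl]
      have := (conn_kSwapInv_of_not_conn_compl hc' h).2
      exact hcm this
  constructor
  · have := conn_contract_of_conn (u := v) (v := c) hTmv.symm
    rwa [mergeTo_self, mergeTo_of_ne hmv] at this
  · intro h
    rcases conn_contract_imp h with h | ⟨_, hm'v | hm'c⟩
    · exact hcm' h
    · exact hTmm (hTmv.trans hm'v.symm)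
    · exact hcm' hm'c.symm

open Classical in
/-- **THEOREM C (b)**: `#DB(cv) ≤ #ac|b(H / e) + #bc|a(H / e)` for an edge `e = cv` of `H` with `v ∉ {a, b}`
(`G = H − e`, `H / e = G.contract v c`, merged vertex `c`). The half of `DB(cv)` with `v ~_S b` is sent by
`kSwap b` into `{the closed cluster of `c` in `H / e` holds `b`, not `a`}`, the half with `v ~_S a` by `kSwap a`
into `{… holds `a`, not `b`}`; the two targets are disjoint and their union has `#ac|b(H / e) + #bc|a(H / e)`
configurations by Lemma Φ (iv) on `H / e`. -/
theorem card_dcDefect_cv_le [Fintype E] {a b c v : V} (hav : a ≠ v) (hbv : b ≠ v) :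
    (univ.filter fun ω : Config E => G.DCDefect ω a b c c v).card ≤
      (univ.filter fun ω : Config E =>
          (G.contract v c).Conn ω c a ∧ ¬ (G.contract v c).Conn ω c b).card +
        (univ.filter fun ω : Config E =>
          (G.contract v c).Conn ω c b ∧ ¬ (G.contract v c).Conn ω c a).card := by
  rw [← card_oneMark_compl_eq (G := G.contract v c) a b c]
  -- the half with `v ~_S b` injects into `{holds b, not a}`
  have hB : (univ.filter fun ω : Config E =>
      G.DCDefect ω a b c c v ∧ G.Conn ω a c ∧ G.Conn ω v b).card ≤
      (univ.filter fun ω : Config E =>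
        (G.contract v c).Conn ωᶜ c b ∧ ¬ (G.contract v c).Conn ωᶜ c a).card := by
    refine Finset.card_le_card_of_injOn (G.kSwap b) ?_ ((G.kSwap_injective b).injOn)
    intro ω hω
    simp only [Finset.coe_filter, Finset.mem_univ, true_and, Set.mem_setOf_eq] at hω ⊢
    obtain ⟨⟨hab, _, hca, _, _⟩, _, hvb⟩ := hω
    exact kSwap_oneMark_contract hbv hvb.symm (fun h => hab h.symm) hca
  -- the half with `v ~_S a` injects into `{holds a, not b}`
  have hA : (univ.filter fun ω : Config E =>
      G.DCDefect ω a b c c v ∧ G.Conn ω a v ∧ G.Conn ω c b).card ≤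
      (univ.filter fun ω : Config E =>
        (G.contract v c).Conn ωᶜ c a ∧ ¬ (G.contract v c).Conn ωᶜ c b).card := by
    refine Finset.card_le_card_of_injOn (G.kSwap a) ?_ ((G.kSwap_injective a).injOn)
    intro ω hω
    simp only [Finset.coe_filter, Finset.mem_univ, true_and, Set.mem_setOf_eq] at hω ⊢
    obtain ⟨⟨hab, _, _, hcb, _⟩, hav', _⟩ := hω
    exact kSwap_oneMark_contract hav hav' hab hcb
  -- `DB(cv)` is covered by its two halves
  have hcover : (univ.filter fun ω : Config E => G.DCDefect ω a b c c v).card ≤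
      (univ.filter fun ω : Config E =>
          G.DCDefect ω a b c c v ∧ G.Conn ω a c ∧ G.Conn ω v b).card +
        (univ.filter fun ω : Config E =>
          G.DCDefect ω a b c c v ∧ G.Conn ω a v ∧ G.Conn ω c b).card := by
    refine le_trans (Finset.card_le_card ?_) (Finset.card_union_le _ _)
    intro ω hω
    simp only [Finset.mem_filter, Finset.mem_univ, true_and, Finset.mem_union] at hω ⊢
    rcases hω.2.1 with h | h
    · exact Or.inl ⟨hω, h⟩
    · exact Or.inr ⟨hω, h⟩
  -- the two targets are the two disjoint halves of the one-mark set of `H / e`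
  have hsplit : (univ.filter fun ω : Config E =>
      ((G.contract v c).Conn ωᶜ c a ∧ ¬ (G.contract v c).Conn ωᶜ c b) ∨
        ((G.contract v c).Conn ωᶜ c b ∧ ¬ (G.contract v c).Conn ωᶜ c a)).card =
      (univ.filter fun ω : Config E =>
          (G.contract v c).Conn ωᶜ c a ∧ ¬ (G.contract v c).Conn ωᶜ c b).card +
        (univ.filter fun ω : Config E =>
          (G.contract v c).Conn ωᶜ c b ∧ ¬ (G.contract v c).Conn ωᶜ c a).card := by
    rw [Finset.filter_or, Finset.card_union_of_disjoint]
    rw [Finset.disjoint_filter]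
    intro ω _ h1 h2
    exact h1.2 h2.1
  rw [hsplit]
  calc _ ≤ _ := hcover
    _ ≤ _ := add_le_add hB hA
    _ = _ := add_comm _ _

end DefectFlips

end MultiGraph

end PercRepro
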